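import Summits.Langlands.Langlands.Theses.QuarterDeficit1951
import Literature.NumberTheory.GaloisRepresentations.GaloisRepUnramifiedProofs
import Literature.NumberTheory.GaloisRepresentations.TateUnramifiedLiftingHolds
import Literature.NumberTheory.GaloisRepresentations.DirichletCharacterOfGaloisCharacter
import Literature.FieldTheory.AlgClosed.PadicAlgClEquivComplex
import Literature.NumberTheory.Automorphic.BCDTTheoremBWildAtThreeDet

/-!
# Route `QuarterDeficit1951` (Langlands) — crux `IcosahedralSupply`: stub `stub_tateTwistLift`

Tate's lifting theorem with ramification control (Serre, Durham 1977, §6.2 Thm. 5; proved in the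
tree, `Tate_projectiveLifting_unramifiedOutside_holds`, run over the discrete copy of `k` and
re-topologised at the end through the open kernel) plus the twist-minimisation at the one ramified
place `v₀` with cyclic decomposition image: `ρ₁(Γ_{ℚ_{v₀}})` is finite and commutative, hence
simultaneously diagonalisable; by local Kronecker–Weber in inertia form `ρ₁|_I = g ∘ χ_{p^m}`, so
the first eigenvalue character extends to the global character `g₁ ∘ χ_{p^m}`, and twisting by its
inverse gives `ρ|_{I_𝔓} = P·diag(1, η)·P⁻¹` at every `𝔓 ∣ v₀`.  Reference: J.-P. Serre, *Modular
forms of weight one and Galois representations* (Durham 1977), §6.2. [`SerreDurham1977`]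
-/

set_option linter.dupNamespace false

noncomputable section

open scoped NumberField MatrixGroups
open Field IsDedekindDomain Polynomial
open Literature.NumberTheory.GaloisRepresentations Literature.NumberTheory.PAdicHodge

namespace Summit.Langlands.Langlands.Theorems.QuarterDeficit1951

open scoped Pointwise

/-! ## Commuting families in `GL₂(k)` and torus-valued homomorphisms -/

section TwoByTwo

variable {k : Type*} [Field k]

/-- **Simultaneous diagonalisation in `GL₂(k)`.** A family of pairwise commuting elements of
finite order of `GL₂(k)` (`k` algebraically closed of characteristic `0`) is conjugate into the
diagonal torus: either all of them are scalar, or one of them has two distinct eigenvalues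
(`GL2.exists_conj_eq_diagonal`) and its centraliser is the torus. [folklore] -/
private theorem GL2_exists_conj_isDg [IsAlgClosed k] [CharZero k] (S : Set (GL (Fin 2) k))
    (hcomm : ∀ x ∈ S, ∀ y ∈ S, x * y = y * x) (hfin : ∀ x ∈ S, ∃ n : ℕ, 0 < n ∧ x ^ n = 1) :
    ∃ P : GL (Fin 2) k, ∀ x ∈ S,
      GL2.IsDg ((P⁻¹ * x * P : GL (Fin 2) k) : Matrix (Fin 2) (Fin 2) k) := by
  by_cases hS : ∀ x ∈ S, x ∈ Subgroup.center (GL (Fin 2) k)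
  · exact ⟨1, fun x hx => by simpa using GL2.isDg_of_mem_center (hS x hx)⟩
  · push Not at hS
    obtain ⟨M, hMS, hM⟩ := hS
    obtain ⟨n, hn, hMn⟩ := hfin M hMS
    obtain ⟨P, d, hd, hP⟩ := GL2.exists_conj_eq_diagonal M hn hMn hM
    refine ⟨P, fun x hx => GL2.isDg_of_commute_diagonal hd ?_⟩
    rw [← hP, ← Units.val_mul, ← Units.val_mul]
    congr 1
    calc P⁻¹ * x * P * (P⁻¹ * M * P) = P⁻¹ * (x * M) * P := by group
      _ = P⁻¹ * (M * x) * P := by rw [hcomm x hx M hMS]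
      _ = P⁻¹ * M * P * (P⁻¹ * x * P) := by group

/-- **The diagonal entries of a torus-valued homomorphism are characters**: if `P⁻¹ f P` is
diagonal on `A`, each of its diagonal entries is a character `A → kˣ`. [folklore] -/
private theorem exists_character_diag_entry {A : Type*} [Group A] (f : A →* GL (Fin 2) k)
    (P : GL (Fin 2) k) (i : Fin 2)
    (hf : ∀ a, GL2.IsDg ((P⁻¹ * f a * P : GL (Fin 2) k) : Matrix (Fin 2) (Fin 2) k)) :
    ∃ ψ : A →* kˣ, ∀ a,
      (ψ a : k) = ((P⁻¹ * f a * P : GL (Fin 2) k) : Matrix (Fin 2) (Fin 2) k) i i := by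
  set F : A →* GL (Fin 2) k := (MulAut.conj P⁻¹).toMonoidHom.comp f with hF_def
  have hF : ∀ a, F a = P⁻¹ * f a * P := fun a => by simp [hF_def]
  have hne : ∀ a, ((F a : GL (Fin 2) k) : Matrix (Fin 2) (Fin 2) k) i i ≠ 0 := fun a => by
    have h := (hF a ▸ hf a).entry_ne_zero (GL2.det_ne_zero (F a))
    fin_cases i
    exacts [h.1, h.2]
  have hmul : ∀ a b, ((F (a * b) : GL (Fin 2) k) : Matrix (Fin 2) (Fin 2) k) i i =
      ((F a : GL (Fin 2) k) : Matrix (Fin 2) (Fin 2) k) i i *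
        ((F b : GL (Fin 2) k) : Matrix (Fin 2) (Fin 2) k) i i := fun a b => by
    have ha := hF a ▸ hf a
    have hb := hF b ▸ hf b
    rw [map_mul, Units.val_mul]
    fin_cases i <;> simp [GL2.mul_fin_two, ha.1, ha.2, hb.1, hb.2]
  refine ⟨MonoidHom.mk' (fun a => Units.mk0 _ (hne a)) fun a b => Units.ext ?_, fun a => ?_⟩
  · simp only [Units.val_mk0, Units.val_mul]
    exact hmul a b
  · simp only [MonoidHom.mk'_apply, Units.val_mk0, hF]

/-- **Normal form on a subgroup.**  If `f : G → GL₂(k)` maps the subgroup `H` into the torus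
`P · diag · P⁻¹` with first diagonal entry `1`, then `f|_H = P · diag(1, η) · P⁻¹` for a character
`η` of `H`. [folklore] -/
private theorem exists_character_eq_conj_diagonal_one {G : Type*} [Group G]
    (f : G →* GL (Fin 2) k) (H : Subgroup G) (P : GL (Fin 2) k)
    (hf : ∀ σ ∈ H, GL2.IsDg ((P⁻¹ * f σ * P : GL (Fin 2) k) : Matrix (Fin 2) (Fin 2) k) ∧
      ((P⁻¹ * f σ * P : GL (Fin 2) k) : Matrix (Fin 2) (Fin 2) k) 0 0 = 1) :
    ∃ η : H →* kˣ, ∀ τ : H,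
      ((f (τ : G) : GL (Fin 2) k) : Matrix (Fin 2) (Fin 2) k) =
        (P : Matrix (Fin 2) (Fin 2) k) * Matrix.diagonal ![(1 : k), (η τ : k)] *
          ((P⁻¹ : GL (Fin 2) k) : Matrix (Fin 2) (Fin 2) k) := by
  obtain ⟨η, hη⟩ := exists_character_diag_entry (f.comp H.subtype) P 1 fun τ => (hf τ τ.2).1
  refine ⟨η, fun τ => ?_⟩
  have hX := (hf τ τ.2).1.eq_diagonal
  rw [(hf τ τ.2).2] at hX
  have e : f (τ : G) = P * (P⁻¹ * f τ * P) * P⁻¹ := by group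
  rw [e, Units.val_mul, Units.val_mul, hX, hη τ]
  rfl

end TwoByTwo

/-! ## The algebraic lifting with normalised inertia at `v₀` -/

/-- **Tate lifting + twist-minimisation, algebraic form** (no topology on `k`): for `k`
algebraically closed of characteristic `0` and `ρ̃ : Γ_ℚ → PGL₂(k)` with open kernel, unramified
away from `v₀` and with cyclic decomposition images above `v₀`, there is `ρ₀ : Γ_ℚ → GL₂(k)` with
open kernel lifting `ρ̃`, trivial on the inertia groups away from `v₀`, with
`ρ₀|_{I_𝔓} = P · diag(1, η) · P⁻¹` for every `𝔓 ∣ v₀` (Serre, Durham 1977, §6.2, proof of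
Thm. 5: Tate's lifting over the discrete copy of `k`, local Kronecker–Weber in inertia form at
`v₀`, twist by the inverse of the globalised first eigenvalue character).
[cite: SerreDurham1977, §6.2 Thm. 5] -/
theorem tateTwistLift_algebraic (k : Type) [Field k] [IsAlgClosed k] [CharZero k]
    (ρt : absoluteGaloisGroup ℚ →* PGL(2, k))
    (hker : IsOpen ((ρt.ker : Subgroup (absoluteGaloisGroup ℚ)) : Set (absoluteGaloisGroup ℚ)))
    (v₀ : HeightOneSpectrum (𝓞 ℚ))
    (hunr : ∀ v : HeightOneSpectrum (𝓞 ℚ), v ≠ v₀ →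
      ∀ 𝔓 ∈ v.primesAbove, ∀ σ ∈ 𝔓.inertia (absoluteGaloisGroup ℚ), ρt σ = 1)
    (hcyc : ∀ 𝔓 ∈ v₀.primesAbove,
      IsCyclic ((𝔓.decompositionSubgroup (absoluteGaloisGroup ℚ)).map ρt)) :
    ∃ ρ₀ : absoluteGaloisGroup ℚ →* GL (Fin 2) k,
      IsOpen ((ρ₀.ker : Subgroup (absoluteGaloisGroup ℚ)) : Set (absoluteGaloisGroup ℚ)) ∧
      (∀ σ, Matrix.ProjGenLinGroup.mk (ρ₀ σ) = ρt σ) ∧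
      (∀ v : HeightOneSpectrum (𝓞 ℚ), v ≠ v₀ →
        ∀ 𝔓 ∈ v.primesAbove, ∀ σ ∈ 𝔓.inertia (absoluteGaloisGroup ℚ), ρ₀ σ = 1) ∧
      ∀ 𝔓 ∈ v₀.primesAbove, ∃ (P : GL (Fin 2) k)
        (η : 𝔓.inertia (absoluteGaloisGroup ℚ) →* kˣ),
        ∀ τ : 𝔓.inertia (absoluteGaloisGroup ℚ),
          ((ρ₀ (τ : absoluteGaloisGroup ℚ) : GL (Fin 2) k) : Matrix (Fin 2) (Fin 2) k) =
            (P : Matrix (Fin 2) (Fin 2) k) * Matrix.diagonal ![(1 : k), (η τ : k)] *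
              ((P⁻¹ : GL (Fin 2) k) : Matrix (Fin 2) (Fin 2) k) := by
  classical
  letI : TopologicalSpace k := ⊥
  haveI : DiscreteTopology k := ⟨rfl⟩
  haveI : IsTopologicalRing k :=
    { continuous_add := continuous_of_discreteTopology
      continuous_mul := continuous_of_discreteTopology
      continuous_neg := continuous_of_discreteTopology }
  -- (1) Tate: a lifting unramified outside `v₀`, over the discrete copy of `k`
  obtain ⟨ρ₁, h₁, hunr₁⟩ := Tate_projectiveLifting_unramifiedOutside_holds 2 k ρt hker {v₀}
    (Set.finite_singleton v₀) (fun v hv => hunr v (fun h => hv (by rw [h]; rfl)))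
  have hker₁ : IsOpen ((ρ₁.toMonoidHom.ker : Subgroup _) : Set (absoluteGaloisGroup ℚ)) := by
    have : ((ρ₁.toMonoidHom.ker : Subgroup _) : Set (absoluteGaloisGroup ℚ)) = ρ₁ ⁻¹' {1} := by
      ext σ; exact MonoidHom.mem_ker
    rw [this]
    exact (isOpen_discrete _).preimage (map_continuous ρ₁)
  -- finite image: every `ρ₁ σ` has finite order
  haveI : CompactSpace (absoluteGaloisGroup ℚ) := absoluteGaloisGroup_compactSpace ℚ
  have hfinord : ∀ σ : absoluteGaloisGroup ℚ, ∃ n : ℕ, 0 < n ∧ (ρ₁ σ) ^ n = 1 := by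
    intro σ
    haveI : Finite (absoluteGaloisGroup ℚ ⧸ ρ₁.toMonoidHom.ker) :=
      Subgroup.quotient_finite_of_isOpen _ hker₁
    obtain ⟨n, hn, hσn⟩ := (isOfFinOrder_of_finite
      (QuotientGroup.mk (s := ρ₁.toMonoidHom.ker) σ)).exists_pow_eq_one
    refine ⟨n, hn, ?_⟩
    rwa [← QuotientGroup.mk_pow, QuotientGroup.eq_one_iff, MonoidHom.mem_ker, map_pow] at hσn
  -- (2) the local structure at `v₀`: `Λ = ρ₁ ∘ res` on `Γ_{ℚ_{v₀}}`
  set p : ℕ := (Rat.HeightOneSpectrum.primesEquiv v₀ : ℕ) with hp_def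
  haveI hp : Fact p.Prime := ⟨(Rat.HeightOneSpectrum.primesEquiv v₀).2⟩
  set 𝔓₀ := adicCompletionPrime ℚ v₀ with h𝔓₀_def
  have h𝔓₀v : 𝔓₀ ∈ v₀.primesAbove := adicCompletionPrime_mem_primesAbove ℚ v₀
  set res := absGaloisRestrict ℚ (v₀.adicCompletion ℚ) with hres_def
  set Λ : absoluteGaloisGroup (v₀.adicCompletion ℚ) →* GL (Fin 2) k :=
    (ρ₁ : absoluteGaloisGroup ℚ →* GL (Fin 2) k).comp res.toMonoidHom with hΛ_def
  set Λt : absoluteGaloisGroup (v₀.adicCompletion ℚ) →* PGL(2, k) := ρt.comp res.toMonoidHom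
    with hΛt_def
  have hΛ_apply : ∀ σ, Λ σ = ρ₁ (res σ) := fun σ => rfl
  have hmkΛ : ∀ σ, Matrix.ProjGenLinGroup.mk (Λ σ) = Λt σ := fun σ => h₁ (res σ)
  have hΛopen :
      IsOpen ((Λ.ker : Subgroup _) : Set (absoluteGaloisGroup (v₀.adicCompletion ℚ))) := by
    have : ((Λ.ker : Subgroup _) : Set (absoluteGaloisGroup (v₀.adicCompletion ℚ))) =
        (fun σ => ρ₁ (res σ)) ⁻¹' {1} := by
      ext σ; exact MonoidHom.mem_ker
    rw [this]
    exact (isOpen_discrete _).preimage ((map_continuous ρ₁).comp res.continuous)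
  -- the image of `Λt` is the cyclic image `ρ̃(D_{𝔓₀})`, so the image of `Λ` is commutative
  haveI hcycΛ : IsCyclic Λt.range := by
    rw [hΛt_def, ← map_decompositionSubgroup_adicCompletionPrime]
    exact hcyc 𝔓₀ h𝔓₀v
  have hcomm : ∀ a b, Λ a * Λ b = Λ b * Λ a := by
    have hF₀ : ∀ x : Λ.range, Matrix.ProjGenLinGroup.mk (x : GL (Fin 2) k) ∈ Λt.range := by
      rintro ⟨_, σ, rfl⟩
      exact ⟨σ, (hmkΛ σ).symm⟩
    set F₀ : Λ.range →* Λt.range :=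
      ((Matrix.ProjGenLinGroup.mk).comp Λ.range.subtype).codRestrict Λt.range hF₀ with hF₀_def
    have hkerF : F₀.ker ≤ Subgroup.center Λ.range := by
      intro x hx
      rw [MonoidHom.mem_ker, hF₀_def] at hx
      have hx' : Matrix.ProjGenLinGroup.mk (x : GL (Fin 2) k) = 1 := congrArg Subtype.val hx
      rw [Matrix.ProjGenLinGroup.mk_eq_one] at hx'
      exact Subgroup.mem_center_iff.mpr fun y => Subtype.ext (Subgroup.mem_center_iff.mp hx' y)
    haveI := MonoidHom.isMulCommutative_of_isCyclic_of_ker_le_center F₀ hkerF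
    intro a b
    exact congrArg Subtype.val (IsMulCommutative.is_comm.comm (⟨Λ a, a, rfl⟩ : Λ.range)
      ⟨Λ b, b, rfl⟩)
  -- (3) local Kronecker–Weber in inertia form: `Λ|_I = g ∘ χ_{p^m}`
  obtain ⟨m, hm, g, hg⟩ :=
    adicCompletion_rat_exists_eq_comp_cyclotomicCharacter_of_mem_absInertia p v₀ rfl Λ hΛopen hcomm
  haveI : NeZero (p ^ m) := ⟨pow_ne_zero _ hp.out.ne_zero⟩
  have hred : ∀ τ : absoluteGaloisGroup ℚ,
      Units.map (PadicInt.toZModPow m).toMonoidHom (GaloisRep.cyclotomicCharacter ℚ p τ) =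
        modNCyclotomicCharacter ℚ (p ^ m) τ := fun τ => Units.ext
    (Literature.NumberTheory.EllipticCurves.toZModPow_cyclotomicCharacter_eq_modNCyclotomicCharacter
      p m τ)
  have h𝔓₀_eq : ∀ σ ∈ 𝔓₀.inertia (absoluteGaloisGroup ℚ),
      ρ₁ σ = g (modNCyclotomicCharacter ℚ (p ^ m) σ) := by
    intro σ hσ
    rw [h𝔓₀_def, inertia_adicCompletionPrime_eq_map_absInertia] at hσ
    obtain ⟨σ', hσ', hσ'eq⟩ := hσ
    have hσ'eq' : res σ' = σ := hσ'eq
    subst hσ'eq'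
    rw [← hred, hres_def, cyclotomicCharacter_absGaloisRestrict, ← hres_def, ← hΛ_apply]
    exact hg σ' hσ'
  -- every value of `g` is a value of `Λ` (`χ_p(I_{ℚ_{v₀}}) = ℤ_pˣ`)
  have hg_range : ∀ a : (ZMod (p ^ m))ˣ, g a ∈ Set.range Λ := by
    intro a
    obtain ⟨u, hu⟩ := PadicInt.unitsMap_toZModPow_surjective p hm a
    obtain ⟨σ, hσ, hσu⟩ :=
      adicCompletion_rat_exists_mem_absInertia_cyclotomicCharacter_eq p v₀ rfl u
    exact ⟨σ, by rw [hg σ hσ, hσu, hu]⟩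
  -- (4) simultaneous diagonalisation of the finite commutative image of `Λ`
  obtain ⟨P, hP⟩ := GL2_exists_conj_isDg (Set.range Λ)
    (by rintro _ ⟨a, rfl⟩ _ ⟨b, rfl⟩; exact hcomm a b) (by rintro _ ⟨a, rfl⟩; exact hfinord (res a))
  -- the first diagonal entry of `P⁻¹ g P` is a character `g₁` of `(ℤ/p^m)ˣ`
  obtain ⟨g₁, hg₁⟩ := exists_character_diag_entry g P 0 fun a => hP (g a) (hg_range a)
  -- (5) the twist `ρ₀ = χ ⊗ ρ₁` by the global character `χ = (g₁ ∘ χ_{p^m})⁻¹`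
  set χ : absoluteGaloisGroup ℚ →* kˣ := (g₁.comp (modNCyclotomicCharacter ℚ (p ^ m)))⁻¹
    with hχ_def
  have hχ_apply : ∀ σ, χ σ = (g₁ (modNCyclotomicCharacter ℚ (p ^ m) σ))⁻¹ := fun σ => rfl
  have hmul : ∀ σ τ : absoluteGaloisGroup ℚ,
      Matrix.GeneralLinearGroup.scalar (Fin 2) (χ (σ * τ)) * ρ₁ (σ * τ) =
        Matrix.GeneralLinearGroup.scalar (Fin 2) (χ σ) * ρ₁ σ *
          (Matrix.GeneralLinearGroup.scalar (Fin 2) (χ τ) * ρ₁ τ) := by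
    intro σ τ
    rw [map_mul, map_mul, map_mul]
    simp only [mul_assoc]
    congr 1
    rw [← mul_assoc (ρ₁ σ), mul_glScalar_comm (χ τ) (ρ₁ σ), mul_assoc]
  set ρ₀ : absoluteGaloisGroup ℚ →* GL (Fin 2) k :=
    MonoidHom.mk' (fun σ => Matrix.GeneralLinearGroup.scalar (Fin 2) (χ σ) * ρ₁ σ) hmul
    with hρ₀_def
  have hρ₀_apply : ∀ σ, ρ₀ σ = Matrix.GeneralLinearGroup.scalar (Fin 2) (χ σ) * ρ₁ σ :=
    fun σ => rfl
  -- the kernel of `ρ₀` contains the open subgroup `ker ρ₁ ∩ ker χ_{p^m}`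
  have hχNopen : IsOpen ((((modNCyclotomicCharacter ℚ (p ^ m)).ker : Subgroup _)) :
      Set (absoluteGaloisGroup ℚ)) := by
    apply Subgroup.isOpen_of_mem_nhds _ (g := 1)
    have hset : ((((modNCyclotomicCharacter ℚ (p ^ m)).ker : Subgroup _)) :
        Set (absoluteGaloisGroup ℚ)) = {σ | modNCyclotomicCharacter ℚ (p ^ m) σ = 1} := by
      ext σ; exact MonoidHom.mem_ker
    rw [hset]
    exact modNCyclotomicCharacter_eventually_eq_one ℚ (p ^ m)
  have hker₀ : IsOpen ((ρ₀.ker : Subgroup _) : Set (absoluteGaloisGroup ℚ)) := by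
    refine Subgroup.isOpen_mono
      (H₁ := ρ₁.toMonoidHom.ker ⊓ (modNCyclotomicCharacter ℚ (p ^ m)).ker) (fun σ hσ => ?_)
      (hker₁.inter hχNopen)
    rw [Subgroup.mem_inf, MonoidHom.mem_ker, MonoidHom.mem_ker] at hσ
    rw [MonoidHom.mem_ker, hρ₀_apply, hχ_apply, hσ.2, map_one, inv_one, map_one, one_mul]
    exact hσ.1
  -- `ρ₀` is unramified away from `v₀` (`χ_{p^m}` is unramified away from `p`)
  have hunr₀ : ∀ v : HeightOneSpectrum (𝓞 ℚ), v ≠ v₀ →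
      ∀ 𝔓 ∈ v.primesAbove, ∀ σ ∈ 𝔓.inertia (absoluteGaloisGroup ℚ), ρ₀ σ = 1 := by
    intro v hv 𝔓 h𝔓 σ hσ
    haveI := h𝔓.1
    have hndvd : ¬ ((Rat.HeightOneSpectrum.primesEquiv v : Nat.Primes) : ℕ) ∣ p ^ m := fun hd => by
      have h1 := (Nat.prime_dvd_prime_iff_eq (Rat.HeightOneSpectrum.primesEquiv v).2 hp.out).mp
        ((Rat.HeightOneSpectrum.primesEquiv v).2.dvd_of_dvd_pow hd)
      exact hv ((Rat.HeightOneSpectrum.primesEquiv).injective (Subtype.ext h1))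
    rw [hρ₀_apply, hχ_apply, modNCyclotomicCharacter_eq_one_of_mem_inertia
      (Rat.natCast_not_mem_of_mem_primesAbove_of_not_dvd h𝔓 hndvd) hσ, map_one, inv_one, map_one,
      one_mul]
    exact hunr₁ v (fun h => hv (by simpa using h)) 𝔓 h𝔓 σ hσ
  -- the shape on `I_{𝔓₀}`: `P⁻¹ ρ₀ P` is diagonal with first entry `1`
  have hkey : ∀ σ ∈ 𝔓₀.inertia (absoluteGaloisGroup ℚ),
      GL2.IsDg ((P⁻¹ * ρ₀ σ * P : GL (Fin 2) k) : Matrix (Fin 2) (Fin 2) k) ∧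
        ((P⁻¹ * ρ₀ σ * P : GL (Fin 2) k) : Matrix (Fin 2) (Fin 2) k) 0 0 = 1 := by
    intro σ hσ
    set a := modNCyclotomicCharacter ℚ (p ^ m) σ with ha
    have hPa := hP (g a) (hg_range a)
    have e : P⁻¹ * ρ₀ σ * P =
        Matrix.GeneralLinearGroup.scalar (Fin 2) (χ σ) * (P⁻¹ * g a * P) := by
      rw [hρ₀_apply, h𝔓₀_eq σ hσ, ← ha, ← mul_assoc P⁻¹, mul_glScalar_comm (χ σ) P⁻¹]
      simp only [mul_assoc]
    have eM : ∀ i j : Fin 2, ((P⁻¹ * ρ₀ σ * P : GL (Fin 2) k) : Matrix (Fin 2) (Fin 2) k) i j =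
        ((χ σ : kˣ) : k) * ((P⁻¹ * g a * P : GL (Fin 2) k) : Matrix (Fin 2) (Fin 2) k) i j := by
      intro i j
      rw [e, Units.val_mul, Matrix.GeneralLinearGroup.coe_scalar, Matrix.scalar_apply,
        Matrix.diagonal_mul]
    refine ⟨⟨?_, ?_⟩, ?_⟩
    · rw [eM, hPa.1, mul_zero]
    · rw [eM, hPa.2, mul_zero]
    · rw [eM, ← hg₁ a, hχ_apply, Units.inv_mul]
  -- (6) the shape at every prime above `v₀`, by conjugation (`𝔓 = τ • 𝔓₀`)
  refine ⟨ρ₀, hker₀, fun σ => ?_, hunr₀, fun 𝔓 h𝔓 => ?_⟩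
  · rw [hρ₀_apply, map_mul, Matrix.ProjGenLinGroup.mk_scalar, one_mul, h₁ σ]
  obtain ⟨τ, rfl⟩ := HeightOneSpectrum.exists_smul_eq_of_mem_primesAbove_holds h𝔓₀v h𝔓
  have hconj : ∀ σ ∈ (τ • 𝔓₀).inertia (absoluteGaloisGroup ℚ),
      τ⁻¹ * σ * τ ∈ 𝔓₀.inertia (absoluteGaloisGroup ℚ) := by
    intro σ hσ x
    have hx : σ • τ • x - τ • x ∈ τ • 𝔓₀ := hσ (τ • x)
    rw [Ideal.mem_pointwise_smul_iff_inv_smul_mem, smul_sub] at hx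
    simpa [mul_smul] using hx
  refine ⟨ρ₀ τ * P, exists_character_eq_conj_diagonal_one ρ₀ _ (ρ₀ τ * P) fun σ hσ => ?_⟩
  have hkey' : (ρ₀ τ * P)⁻¹ * ρ₀ σ * (ρ₀ τ * P) = P⁻¹ * ρ₀ (τ⁻¹ * σ * τ) * P := by
    rw [map_mul, map_mul, map_inv]
    group
  rw [hkey']
  exact hkey _ (hconj σ hσ)

/-! ## The registered stub -/

/-- **Stub (Tate lifting + twist-minimisation).** A projective representation `ρ̃ : Γ_ℚ → PGL₂(k)`
(`k` algebraically closed of characteristic `0`, any ring topology) with open kernel, unramified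
away from one finite place `v₀`, and with CYCLIC image of every decomposition group above `v₀`,
has a lifting `ρ : Γ_ℚ → GL₂(k)` with open kernel, unramified away from `v₀`, whose restriction to
each inertia group above `v₀` is `P · diag(1, η) · P⁻¹` for a character `η` of that inertia group
(Tate, Serre Durham 1977 §6.2 Thm. 5, proved in the tree as
`Tate_projectiveLifting_unramifiedOutside_holds`, applied over the discrete copy of `k`; then twist
by a global character with prescribed inertial restriction, local Kronecker–Weber).
[cite: SerreDurham1977, §6.2 Thm. 5] -/
theorem stub_tateTwistLift (k : Type) [Field k] [IsAlgClosed k] [CharZero k] [TopologicalSpace k]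
    [IsTopologicalRing k] (ρt : absoluteGaloisGroup ℚ →* PGL(2, k))
    (hker : IsOpen ((ρt.ker : Subgroup (absoluteGaloisGroup ℚ)) : Set (absoluteGaloisGroup ℚ)))
    (v₀ : HeightOneSpectrum (𝓞 ℚ))
    (hunr : ∀ v : HeightOneSpectrum (𝓞 ℚ), v ≠ v₀ →
      ∀ 𝔓 ∈ v.primesAbove, ∀ σ ∈ 𝔓.inertia (absoluteGaloisGroup ℚ), ρt σ = 1)
    (hcyc : ∀ 𝔓 ∈ v₀.primesAbove,
      IsCyclic ((𝔓.decompositionSubgroup (absoluteGaloisGroup ℚ)).map ρt)) :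
    ∃ ρ : FramedGaloisRep ℚ k 2,
      IsOpen ((ρ.toMonoidHom.ker : Subgroup (absoluteGaloisGroup ℚ)) : Set (absoluteGaloisGroup ℚ)) ∧
      IsProjectiveLift ρt ρ ∧
      (∀ v : HeightOneSpectrum (𝓞 ℚ), v ≠ v₀ → ρ.IsUnramifiedAt v) ∧
      ∀ 𝔓 ∈ v₀.primesAbove, ∃ (P : GL (Fin 2) k)
        (η : 𝔓.inertia (absoluteGaloisGroup ℚ) →* kˣ),
        ∀ τ : 𝔓.inertia (absoluteGaloisGroup ℚ),
          ((ρ (τ : absoluteGaloisGroup ℚ) : GL (Fin 2) k) : Matrix (Fin 2) (Fin 2) k) =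
            (P : Matrix (Fin 2) (Fin 2) k) * Matrix.diagonal ![(1 : k), (η τ : k)] *
              ((P⁻¹ : GL (Fin 2) k) : Matrix (Fin 2) (Fin 2) k) := by
  obtain ⟨ρ₀, hker₀, hlift, hunr₀, hshape⟩ := tateTwistLift_algebraic k ρt hker v₀ hunr hcyc
  exact ⟨⟨ρ₀, MonoidHom.continuous_of_isOpen_ker ρ₀ hker₀⟩, hker₀, fun σ => hlift σ,
    fun v hv => hunr₀ v hv, hshape⟩

end Summit.Langlands.Langlands.Theorems.QuarterDeficit1951

end
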